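import Summits.AtomisticToContinuum.Crystallization.Theorems.ChartedZeroExcessLayeredLatticeLiouvilleZZN

/-!
# (B′.4a) rider ZZO — CONE PINS, bridge (c1c): the two competitor classes at a charted site

Lineage `stmt-AtomisticToContinuum-26636` (route ChartedPlanarOrder), lens-2 g81, cone-pin programme (B′) (critic row 1471 (C)).  Rider ZZH's cell test
admits, besides the centre, only two classes of COMPETITOR offsets `z ∈ cellAllowed`: DOUBLES (`|ι z|² = 72`, cap `1/2` against every corner) and APEXES
(`|ι z|² = 48`, cap `5/9`).  Rider ZZJ proved, for abstract pattern data, that the atom at such an offset lies in the `60°`-cone of the pinning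
direction (`double_cone`, `apex_cone`) at distance `≥ 7a′/4` resp. `≥ 3a′/2`.  This file identifies the pattern data INSIDE THE CHART:

* §1 INDEX SIDE (kernel `decide`, python-prechecked `g81/dev/zzn_check.py`).  `linkCode ℓ y v` = the code of the site `v` in the coded link of `y`.
  CLASS (I) `classI_dec`: a double `z` is `ι z = 2 ιTab i` for a first-shell code `i` of the centre, and in the link of the MIDPOINT `n = linkPt L 0 i` the
  centre and `z` carry ANTIPODAL table vectors (`classIB`).  CLASS (II) `classII_dec`: an apex `z` has a CAP ATOM `q = linkPt L 0 iq` and two link codes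
  `i₁, i₂` of the centre with `2(3ιTab iq − ιTab i₁ − ιTab i₂) = 3 ι z`, `|3ιTab iq − ιTab i₁ − ιTab i₂|² = 108`, and in the link of `q` the centre, the two
  atoms and `z` have codes `jx, j₁, j₂, jz` with `|Q jx + Q j₁ + Q j₂|² = 108`, `3(Q jz − Q jx) = −2(Q jx + Q j₁ + Q j₂)` (`classIIB`) — literally the
  hypotheses `hN, hM, hQz` of rider ZZJ's `apex_cone`.
* §2 REAL SIDE.  With rider ZZN's pulled-back direction and cap transport, rider ZZK's frame at the midpoint / cap atom (`dist_linkPt_frame`, its OWN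
  scale `a′ ∈ [9/10, 1]` — never compared with the centre's) and rider ZZM's frame at the centre: ★ `classI_cone`, ★ `classII_cone` — the atom
  `Ψ (x + z)` lies in the `60°`-cone of `w` at `Ψ x`, at distance in `[63/40, 17/8]` resp. `[27/20, 44/25]`.
* §3 ★★ `competitor_cone`: every allowed competitor offset `z ∈ cellAllowed L cs` of the cell of rider ZZN's `cell_at_site` is realised by a charted atom
  in the `60°`-cone of `w` at `Ψ x` with `27/20 ≤ dist ≤ 43/20` — the competitor half of the pin step (the member half is `cell_at_site`).

0 sorry; kernel `decide` only.
-/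

open scoped RealInnerProductSpace
open Literature.Geometry.DiscreteGeometry (intVec intVec_apply norm_intVec sqNormInt dotInt IsTwoShellGoodSet intVec_add intVec_sub intVec_zsmul)

namespace Summit.AtomisticToContinuum.Crystallization.Theorems.ChartedZeroExcessLayeredLatticeLiouville

open Summit.AtomisticToContinuum.Crystallization.Theorems.ChartedPlanarOrderRigidityDoor (E3)

/-! ## ZZO-1  Index side: the structure of the two competitor classes -/

/-- the code of the site `v` in the coded link of `y` (first match; `0` when `v` is not a link site of `y`). [this file, g81] -/
def linkCode (ℓ : ℤ → Bool) (y v : ℤ × ℤ × ℤ) : Fin 12 :=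
  ((List.finRange 12).find? fun j => linkPt ℓ y j = v).getD 0

/-- CLASS (I) data of a double `z` at the first-shell code `i` (letters `ℓ`, centre table `β γ`): `ι z = 2 ιTab i`; in the link of the midpoint
`n = linkPt ℓ 0 i` the codes `j₁ = linkCode ℓ n 0`, `j₂ = linkCode ℓ n z` do code `0` and `z`, with ANTIPODAL table vectors in `n`'s own table.
[this file, g81] -/
def classIB (ℓ : ℤ → Bool) (β γ : Bool) (z : ℤ × ℤ × ℤ) (i : Fin 12) : Bool :=
  let n := linkPt ℓ 0 i
  let j₁ := linkCode ℓ n 0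
  let j₂ := linkCode ℓ n z
  decide (iota ℓ z = iotaTab β γ i + iotaTab β γ i) && decide (linkPt ℓ n j₁ = 0) && decide (linkPt ℓ n j₂ = z) &&
    decide (iotaTab (ℓ (n.1 - 1)) (ℓ n.1) j₂ = -iotaTab (ℓ (n.1 - 1)) (ℓ n.1) j₁)

/-- CLASS (II) data of an apex `z` at the codes `iq` (cap atom `q = linkPt ℓ 0 iq`), `i₁, i₂` (two more link atoms `h₁, h₂` of the centre):
x-side `2·N = 3·ι z`, `|N|² = 108` for `N = 3ιTab iq − ιTab i₁ − ιTab i₂`; q-side: the codes of `0, h₁, h₂, z` in the link of `q` and, in `q`'s own table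
`Q`, `|Q jx + Q j₁ + Q j₂|² = 108` and `3(Q jz − Q jx) = −2(Q jx + Q j₁ + Q j₂)`. [this file, g81] -/
def classIIB (ℓ : ℤ → Bool) (β γ : Bool) (z : ℤ × ℤ × ℤ) (iq i₁ i₂ : Fin 12) : Bool :=
  let q := linkPt ℓ 0 iq
  let h₁ := linkPt ℓ 0 i₁
  let h₂ := linkPt ℓ 0 i₂
  let jx := linkCode ℓ q 0
  let j₁ := linkCode ℓ q h₁
  let j₂ := linkCode ℓ q h₂
  let jz := linkCode ℓ q z
  let N := iotaTab β γ iq + iotaTab β γ iq + iotaTab β γ iq - iotaTab β γ i₁ - iotaTab β γ i₂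
  let M := iotaTab (ℓ (q.1 - 1)) (ℓ q.1) jx + iotaTab (ℓ (q.1 - 1)) (ℓ q.1) j₁ + iotaTab (ℓ (q.1 - 1)) (ℓ q.1) j₂
  let Dz := iotaTab (ℓ (q.1 - 1)) (ℓ q.1) jz - iotaTab (ℓ (q.1 - 1)) (ℓ q.1) jx
  decide (N + N = iota ℓ z + iota ℓ z + iota ℓ z) && decide (sqNormInt N = 108) &&
    decide (linkPt ℓ q jx = 0) && decide (linkPt ℓ q j₁ = h₁) && decide (linkPt ℓ q j₂ = h₂) && decide (linkPt ℓ q jz = z) &&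
    decide (sqNormInt M = 108) && decide (Dz + Dz + Dz = -(M + M))

/-- ★ CLASS (I) STRUCTURE: every two-step offset of squared norm `72` is a double with the data `classIB` at some first-shell code (kernel `decide`,
`16` contexts). [this file, g81] -/
theorem classI_dec : ∀ (a b c d : Bool), ∀ z ∈ twoStep (letters4 a b c d), sqNormInt (iota (letters4 a b c d) z) = 72 →
    ∃ i : Fin 12, classIB (letters4 a b c d) b c z i = true := by
  decide +kernel

/-- ★ CLASS (II) STRUCTURE: every two-step offset of squared norm `48` is an apex with the data `classIIB` at some triple of codes (kernel `decide`).
[this file, g81] -/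
theorem classII_dec : ∀ (a b c d : Bool), ∀ z ∈ twoStep (letters4 a b c d), sqNormInt (iota (letters4 a b c d) z) = 48 →
    ∃ iq i₁ i₂ : Fin 12, classIIB (letters4 a b c d) b c z iq i₁ i₂ = true := by
  decide +kernel

/-- [formal bookkeeping] -/
theorem classIB_sound {ℓ : ℤ → Bool} {β γ : Bool} {z : ℤ × ℤ × ℤ} {i : Fin 12} (h : classIB ℓ β γ z i = true) :
    iota ℓ z = iotaTab β γ i + iotaTab β γ i ∧ linkPt ℓ (linkPt ℓ 0 i) (linkCode ℓ (linkPt ℓ 0 i) 0) = 0 ∧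
      linkPt ℓ (linkPt ℓ 0 i) (linkCode ℓ (linkPt ℓ 0 i) z) = z ∧
      iotaTab (ℓ ((linkPt ℓ 0 i).1 - 1)) (ℓ (linkPt ℓ 0 i).1) (linkCode ℓ (linkPt ℓ 0 i) z) =
        -iotaTab (ℓ ((linkPt ℓ 0 i).1 - 1)) (ℓ (linkPt ℓ 0 i).1) (linkCode ℓ (linkPt ℓ 0 i) 0) := by
  simp only [classIB, Bool.and_eq_true, decide_eq_true_eq] at h
  exact ⟨h.1.1.1, h.1.1.2, h.1.2, h.2⟩

/-- [formal bookkeeping] -/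
theorem classIIB_sound {ℓ : ℤ → Bool} {β γ : Bool} {z : ℤ × ℤ × ℤ} {iq i₁ i₂ : Fin 12} (h : classIIB ℓ β γ z iq i₁ i₂ = true) :
    (iotaTab β γ iq + iotaTab β γ iq + iotaTab β γ iq - iotaTab β γ i₁ - iotaTab β γ i₂) +
        (iotaTab β γ iq + iotaTab β γ iq + iotaTab β γ iq - iotaTab β γ i₁ - iotaTab β γ i₂) = iota ℓ z + iota ℓ z + iota ℓ z ∧
      sqNormInt (iotaTab β γ iq + iotaTab β γ iq + iotaTab β γ iq - iotaTab β γ i₁ - iotaTab β γ i₂) = 108 ∧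
      linkPt ℓ (linkPt ℓ 0 iq) (linkCode ℓ (linkPt ℓ 0 iq) 0) = 0 ∧
      linkPt ℓ (linkPt ℓ 0 iq) (linkCode ℓ (linkPt ℓ 0 iq) (linkPt ℓ 0 i₁)) = linkPt ℓ 0 i₁ ∧
      linkPt ℓ (linkPt ℓ 0 iq) (linkCode ℓ (linkPt ℓ 0 iq) (linkPt ℓ 0 i₂)) = linkPt ℓ 0 i₂ ∧
      linkPt ℓ (linkPt ℓ 0 iq) (linkCode ℓ (linkPt ℓ 0 iq) z) = z ∧
      sqNormInt (iotaTab (ℓ ((linkPt ℓ 0 iq).1 - 1)) (ℓ (linkPt ℓ 0 iq).1) (linkCode ℓ (linkPt ℓ 0 iq) 0) +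
          iotaTab (ℓ ((linkPt ℓ 0 iq).1 - 1)) (ℓ (linkPt ℓ 0 iq).1) (linkCode ℓ (linkPt ℓ 0 iq) (linkPt ℓ 0 i₁)) +
          iotaTab (ℓ ((linkPt ℓ 0 iq).1 - 1)) (ℓ (linkPt ℓ 0 iq).1) (linkCode ℓ (linkPt ℓ 0 iq) (linkPt ℓ 0 i₂))) = 108 ∧
      (let Q := iotaTab (ℓ ((linkPt ℓ 0 iq).1 - 1)) (ℓ (linkPt ℓ 0 iq).1)
       let Dz := Q (linkCode ℓ (linkPt ℓ 0 iq) z) - Q (linkCode ℓ (linkPt ℓ 0 iq) 0)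
       let M := Q (linkCode ℓ (linkPt ℓ 0 iq) 0) + Q (linkCode ℓ (linkPt ℓ 0 iq) (linkPt ℓ 0 i₁)) + Q (linkCode ℓ (linkPt ℓ 0 iq) (linkPt ℓ 0 i₂))
       Dz + Dz + Dz = -(M + M)) := by
  simp only [classIIB, Bool.and_eq_true, decide_eq_true_eq] at h
  exact ⟨h.1.1.1.1.1.1.1, h.1.1.1.1.1.1.2, h.1.1.1.1.1.2, h.1.1.1.1.2, h.1.1.1.2, h.1.1.2, h.1.2, h.2⟩

/-- the letters read at a link site of `x`: those of the context of `x`, re-based at the first-shell offset. [formal bookkeeping] -/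
theorem letters_at_linkPt (τ : ℤ → Bool) (x : ℤ × ℤ × ℤ) (i : Fin 12) :
    τ ((linkPt τ x i).1 - 1) = letters4 (τ (x.1 - 2)) (τ (x.1 - 1)) (τ x.1) (τ (x.1 + 1))
        ((linkPt (letters4 (τ (x.1 - 2)) (τ (x.1 - 1)) (τ x.1) (τ (x.1 + 1))) 0 i).1 - 1) ∧
      τ (linkPt τ x i).1 = letters4 (τ (x.1 - 2)) (τ (x.1 - 1)) (τ x.1) (τ (x.1 + 1))
        (linkPt (letters4 (τ (x.1 - 2)) (τ (x.1 - 1)) (τ x.1) (τ (x.1 + 1))) 0 i).1 := by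
  have hs := shell1_fst (letters4 (τ (x.1 - 2)) (τ (x.1 - 1)) (τ x.1) (τ (x.1 + 1))) _ (mem_shell1.2 ⟨i, rfl⟩)
  rw [linkPt_eq_add_letters4 τ x i, Prod.fst_add]
  constructor
  · rw [add_sub_assoc]
    exact letters4_shift τ x _ (by omega) (by omega)
  · exact letters4_shift τ x _ (by omega) hs.2

/-! ## ZZO-2  Real side: the two competitor cones at a charted site -/

/-- [formal bookkeeping; inline twin of the tree's `…DefectFreeCrystallizes.Negative.TypeGap.intVec_neg` /
`…LayeredLawsSelectHcp.Negative.IntegerForms.intVec_neg`, which are not in this file's import cone — kept `private`] -/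
private theorem intVec_neg (v : Fin 3 → ℤ) : intVec (-v) = -intVec v := by
  have h := intVec_sub 0 v
  rw [zero_sub] at h
  rw [← h, show intVec (0 : Fin 3 → ℤ) = 0 from by rw [← sub_self v, ← intVec_sub, sub_self], zero_sub]

/-- antipodal table vectors have antipodal ideal positions. [formal bookkeeping] -/
theorem iotaPt_eq_neg_of_tab {α β : Bool} {j₁ j₂ : Fin 12} (h : iotaTab α β j₂ = -iotaTab α β j₁) : iotaPt α β j₂ = -iotaPt α β j₁ := by
  rw [iotaPt, iotaPt, h, intVec_neg, smul_neg]

/-- a framed integer vector of squared norm `108 = 6·18` has length `√6 · a`. [formal bookkeeping] -/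
theorem norm_frame_of_sq108 (F : E3 →ₗᵢ[ℝ] E3) {a : ℝ} (ha : 0 ≤ a) {s : Fin 3 → ℤ} (hs : sqNormInt s = 108) :
    ‖a • F ((Real.sqrt 18)⁻¹ • intVec s)‖ = Real.sqrt 6 * a := by
  have h := norm_scaled_sq (N := 18) (by norm_num) s
  rw [show ((18 : ℕ) : ℝ) = 18 from by norm_num, hs] at h
  have h6 : ‖(Real.sqrt 18)⁻¹ • intVec s‖ = Real.sqrt 6 := by
    rw [← Real.sqrt_sq (norm_nonneg ((Real.sqrt 18)⁻¹ • intVec s)), h]; norm_num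
  rw [norm_smul, F.norm_map, h6, Real.norm_of_nonneg ha, mul_comm]

/-- [formal bookkeeping] -/
theorem norm_frame_iotaPt (F : E3 →ₗᵢ[ℝ] E3) {a : ℝ} (ha : 0 ≤ a) (α β : Bool) (i : Fin 12) : ‖a • F (iotaPt α β i)‖ = a := by
  rw [norm_smul, F.norm_map, norm_iotaPt, mul_one, Real.norm_of_nonneg ha]

/-- ★ CLASS (I) CONE.  At a charted site `x` (chart of the two-shell-clean `S`, two shells inside the chart domain) with the centre's frame `a, F` on
the first shell and the pulled-back direction `w'`: a double `z` (data `classIB` at code `i`) whose offset passes the cap `1/2` against `w'` is realised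
by the charted atom `Ψ (x + z)` in the `60°`-cone of `w` at `Ψ x`, at distance in `[63/40, 17/8]` — rider ZZJ `double_cone` / `double_norm_bounds` with
the midpoint's OWN frame (rider ZZK `dist_linkPt_frame`); no two frames or scales are ever compared. [this file, g81] -/
theorem classI_cone {S : Set E3} {D : Set (ℤ × ℤ × ℤ)} {Ψ : ℤ × ℤ × ℤ → E3} {τ : ℤ → Bool} (hΨ : IsBarlowBondChart S D Ψ τ)
    {x : ℤ × ℤ × ℤ} (hlD : ∀ i, linkPt τ x i ∈ D) (hl2D : ∀ i j, linkPt τ (linkPt τ x i) j ∈ D)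
    (hclean : ∀ p ∈ S, IsTwoShellGoodSet (1 / 16) (9 / 10) 1 S p) {w w' : E3} {a : ℝ} {F : E3 →ₗᵢ[ℝ] E3}
    (ha : 9 / 10 ≤ a) (hn : ‖w'‖ = ‖w‖) (hFw : ∀ u : E3, ⟪F u, w⟫ = ⟪u, w'⟫)
    (hF1 : ∀ i : Fin 12, dist (Ψ (linkPt τ x i)) (Ψ x + a • F (iotaPt (τ (x.1 - 1)) (τ x.1) i)) ≤ 1 / 16 * a)
    {L : ℤ → Bool} (hL : letters4 (τ (x.1 - 2)) (τ (x.1 - 1)) (τ x.1) (τ (x.1 + 1)) = L)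
    {z : ℤ × ℤ × ℤ} {i : Fin 12} (hcl : classIB L (τ (x.1 - 1)) (τ x.1) z i = true)
    (hcap : Real.sqrt ((1 : ℕ) / (2 : ℕ)) * (‖intVec (iota L z)‖ * ‖w'‖) ≤ ⟪intVec (iota L z), w'⟫) :
    1 / 2 * (‖Ψ (x + z) - Ψ x‖ * ‖w‖) ≤ ⟪Ψ (x + z) - Ψ x, w⟫ ∧ 63 / 40 ≤ dist (Ψ (x + z)) (Ψ x) ∧ dist (Ψ (x + z)) (Ψ x) ≤ 17 / 8 := by
  obtain ⟨hι, hj₁, hj₂, hanti⟩ := classIB_sound hcl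
  have hapos : 0 < a := by linarith
  -- the midpoint `linkPt τ x i` and its own frame
  obtain ⟨a', ha', ha1', F', hF'⟩ := dist_linkPt_frame hΨ (hlD i) (fun j => hl2D i j) (hclean _ (hΨ.2.1 (hlD i)))
  have ha'pos : 0 < a' := by linarith
  obtain ⟨hl₁, hl₀⟩ := letters_at_linkPt τ x i
  rw [hL] at hl₁ hl₀
  have hp := hF' (linkCode L (linkPt L 0 i) 0)
  have hz := hF' (linkCode L (linkPt L 0 i) z)
  rw [linkPt_linkPt_eq_add_letters4, hL, hj₁, add_zero, hl₁, hl₀] at hp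
  rw [linkPt_linkPt_eq_add_letters4, hL, hj₂, hl₁, hl₀, iotaPt_eq_neg_of_tab hanti, map_neg, smul_neg, ← sub_eq_add_neg] at hz
  -- the x-pattern: member direction `a • F (ιPt i)`, cap `√(1/2)` transported from the double's integer cap
  have hU := norm_frame_iotaPt F hapos.le (τ (x.1 - 1)) (τ x.1) i
  have hwU : Real.sqrt (1 / 2) * (‖a • F (iotaPt (τ (x.1 - 1)) (τ x.1) i)‖ * ‖w‖) ≤ ⟪a • F (iotaPt (τ (x.1 - 1)) (τ x.1) i), w⟫ := by
    have hc : Real.sqrt (((1 : ℕ) : ℝ) / ((2 : ℕ) : ℝ)) = Real.sqrt (1 / 2) := by norm_num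
    rw [hc, hι, intVec_add, ← two_smul ℝ] at hcap
    have e3 : a • F (iotaPt (τ (x.1 - 1)) (τ x.1) i) =
        (a * (Real.sqrt 18)⁻¹ * 2⁻¹) • F ((2 : ℝ) • intVec (iotaTab (τ (x.1 - 1)) (τ x.1) i)) := by
      rw [iotaPt, F.map_smul, F.map_smul, smul_smul, smul_smul]
      congr 1
      ring
    rw [e3]
    exact inner_ge_transport hFw hn hcap (by positivity)
  have hU' := norm_frame_iotaPt F' ha'pos.le (L ((linkPt L 0 i).1 - 1)) (L (linkPt L 0 i).1) (linkCode L (linkPt L 0 i) 0)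
  refine ⟨double_cone hapos hU (hF1 i) hwU ha'pos hU' hp hz, ?_⟩
  obtain ⟨hlo, hhi⟩ := double_norm_bounds hU' hp hz
  rw [dist_eq_norm]
  constructor <;> nlinarith

/-- the x-side apex vector in integer form. [formal bookkeeping] -/
theorem frame_apex_combo (F : E3 →ₗᵢ[ℝ] E3) (a : ℝ) (α β : Bool) (iq i₁ i₂ : Fin 12) :
    (3 : ℝ) • (a • F (iotaPt α β iq)) - a • F (iotaPt α β i₁) - a • F (iotaPt α β i₂) =
      a • F ((Real.sqrt 18)⁻¹ • intVec (iotaTab α β iq + iotaTab α β iq + iotaTab α β iq - iotaTab α β i₁ - iotaTab α β i₂)) := by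
  simp only [iotaPt, intVec_add, ← intVec_sub, map_add, map_sub, LinearIsometry.map_smul, smul_add, smul_sub]
  module

/-- the q-side sum of three framed table vectors in integer form. [formal bookkeeping] -/
theorem frame_sum3 (F : E3 →ₗᵢ[ℝ] E3) (a : ℝ) (α β : Bool) (j₀ j₁ j₂ : Fin 12) :
    a • F (iotaPt α β j₀) + a • F (iotaPt α β j₁) + a • F (iotaPt α β j₂) =
      a • F ((Real.sqrt 18)⁻¹ • intVec (iotaTab α β j₀ + iotaTab α β j₁ + iotaTab α β j₂)) := by
  simp only [iotaPt, intVec_add, map_add, LinearIsometry.map_smul, smul_add]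

/-- [formal bookkeeping] -/
theorem frame_sub (F : E3 →ₗᵢ[ℝ] E3) (a : ℝ) (α β : Bool) (jz jx : Fin 12) :
    a • F (iotaPt α β jz) - a • F (iotaPt α β jx) = a • F ((Real.sqrt 18)⁻¹ • intVec (iotaTab α β jz - iotaTab α β jx)) := by
  simp only [iotaPt, ← intVec_sub, map_sub, LinearIsometry.map_smul, smul_sub]

/-- ★ CLASS (II) CONE.  At a charted site `x` as above: an apex `z` (data `classIIB` at codes `iq, i₁, i₂`) whose offset passes the cap `5/9` against
`w'` is realised by `Ψ (x + z)` in the `60°`-cone of `w` at `Ψ x`, at distance in `[27/20, 44/25]` — rider ZZJ `apex_cone` / `apex_norm_bounds` with the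
centre's frame for the x-pattern and the cap atom's OWN frame (rider ZZK) for the c-pattern. [this file, g81] -/
theorem classII_cone {S : Set E3} {D : Set (ℤ × ℤ × ℤ)} {Ψ : ℤ × ℤ × ℤ → E3} {τ : ℤ → Bool} (hΨ : IsBarlowBondChart S D Ψ τ)
    {x : ℤ × ℤ × ℤ} (hlD : ∀ i, linkPt τ x i ∈ D) (hl2D : ∀ i j, linkPt τ (linkPt τ x i) j ∈ D)
    (hclean : ∀ p ∈ S, IsTwoShellGoodSet (1 / 16) (9 / 10) 1 S p) {w w' : E3} {a : ℝ} {F : E3 →ₗᵢ[ℝ] E3}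
    (ha : 9 / 10 ≤ a) (hn : ‖w'‖ = ‖w‖) (hFw : ∀ u : E3, ⟪F u, w⟫ = ⟪u, w'⟫)
    (hF1 : ∀ i : Fin 12, dist (Ψ (linkPt τ x i)) (Ψ x + a • F (iotaPt (τ (x.1 - 1)) (τ x.1) i)) ≤ 1 / 16 * a)
    {L : ℤ → Bool} (hL : letters4 (τ (x.1 - 2)) (τ (x.1 - 1)) (τ x.1) (τ (x.1 + 1)) = L)
    {z : ℤ × ℤ × ℤ} {iq i₁ i₂ : Fin 12} (hcl : classIIB L (τ (x.1 - 1)) (τ x.1) z iq i₁ i₂ = true)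
    (hcap : Real.sqrt ((5 : ℕ) / (9 : ℕ)) * (‖intVec (iota L z)‖ * ‖w'‖) ≤ ⟪intVec (iota L z), w'⟫) :
    1 / 2 * (‖Ψ (x + z) - Ψ x‖ * ‖w‖) ≤ ⟪Ψ (x + z) - Ψ x, w⟫ ∧ 27 / 20 ≤ dist (Ψ (x + z)) (Ψ x) ∧ dist (Ψ (x + z)) (Ψ x) ≤ 44 / 25 := by
  obtain ⟨hN2, hN108, hjx, hj₁, hj₂, hjz, hM108, hDz⟩ := classIIB_sound hcl
  have hapos : 0 < a := by linarith
  -- the cap atom `linkPt τ x iq` and its own frame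
  obtain ⟨a', ha', ha1', F', hF'⟩ := dist_linkPt_frame hΨ (hlD iq) (fun j => hl2D iq j) (hclean _ (hΨ.2.1 (hlD iq)))
  have ha'pos : 0 < a' := by linarith
  obtain ⟨hl₁, hl₀⟩ := letters_at_linkPt τ x iq
  rw [hL] at hl₁ hl₀
  -- the four c-pattern positions: centre, the two link atoms, the apex
  have hx := hF' (linkCode L (linkPt L 0 iq) 0)
  have hh₁' := hF' (linkCode L (linkPt L 0 iq) (linkPt L 0 i₁))
  have hh₂' := hF' (linkCode L (linkPt L 0 iq) (linkPt L 0 i₂))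
  have hz := hF' (linkCode L (linkPt L 0 iq) z)
  rw [linkPt_linkPt_eq_add_letters4, hL, hjx, add_zero, hl₁, hl₀] at hx
  rw [linkPt_linkPt_eq_add_letters4, hL, hj₁, ← hL, ← linkPt_eq_add_letters4, hL, hl₁, hl₀] at hh₁'
  rw [linkPt_linkPt_eq_add_letters4, hL, hj₂, ← hL, ← linkPt_eq_add_letters4, hL, hl₁, hl₀] at hh₂'
  rw [linkPt_linkPt_eq_add_letters4, hL, hjz, hl₁, hl₀] at hz
  -- x-pattern: N = 3 P_c − P₁ − P₂ has length √6·a and carries the transported cap √(5/9)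
  have eN := frame_apex_combo F a (τ (x.1 - 1)) (τ x.1) iq i₁ i₂
  have hN : ‖(3 : ℝ) • (a • F (iotaPt (τ (x.1 - 1)) (τ x.1) iq)) - a • F (iotaPt (τ (x.1 - 1)) (τ x.1) i₁) -
      a • F (iotaPt (τ (x.1 - 1)) (τ x.1) i₂)‖ = Real.sqrt 6 * a := by
    rw [eN]; exact norm_frame_of_sq108 F hapos.le hN108
  have hwN : Real.sqrt (5 / 9) * (‖(3 : ℝ) • (a • F (iotaPt (τ (x.1 - 1)) (τ x.1) iq)) - a • F (iotaPt (τ (x.1 - 1)) (τ x.1) i₁) -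
      a • F (iotaPt (τ (x.1 - 1)) (τ x.1) i₂)‖ * ‖w‖) ≤
      ⟪(3 : ℝ) • (a • F (iotaPt (τ (x.1 - 1)) (τ x.1) iq)) - a • F (iotaPt (τ (x.1 - 1)) (τ x.1) i₁) -
        a • F (iotaPt (τ (x.1 - 1)) (τ x.1) i₂), w⟫ := by
    have hc : Real.sqrt (((5 : ℕ) : ℝ) / ((9 : ℕ) : ℝ)) = Real.sqrt (5 / 9) := by norm_num
    rw [hc] at hcap
    have e2 : intVec (iotaTab (τ (x.1 - 1)) (τ x.1) iq + iotaTab (τ (x.1 - 1)) (τ x.1) iq + iotaTab (τ (x.1 - 1)) (τ x.1) iq -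
        iotaTab (τ (x.1 - 1)) (τ x.1) i₁ - iotaTab (τ (x.1 - 1)) (τ x.1) i₂) = ((3 : ℝ) / 2) • intVec (iota L z) := by
      have h2 := congrArg intVec hN2
      rw [intVec_add] at h2
      rw [show intVec (iotaTab (τ (x.1 - 1)) (τ x.1) iq + iotaTab (τ (x.1 - 1)) (τ x.1) iq + iotaTab (τ (x.1 - 1)) (τ x.1) iq -
          iotaTab (τ (x.1 - 1)) (τ x.1) i₁ - iotaTab (τ (x.1 - 1)) (τ x.1) i₂) = ((1 : ℝ) / 2) • (intVec (iota L z + iota L z + iota L z))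
          from by rw [← h2]; module, intVec_add, intVec_add]
      module
    rw [eN, e2, LinearIsometry.map_smul, LinearIsometry.map_smul, smul_smul, smul_smul]
    exact inner_ge_transport hFw hn hcap (by positivity)
  -- q-pattern: M = Qx + Q₁ + Q₂ has length √6·a′ and Qz − Qx = −(2/3)·M
  have eM := frame_sum3 F' a' (L ((linkPt L 0 iq).1 - 1)) (L (linkPt L 0 iq).1) (linkCode L (linkPt L 0 iq) 0)
    (linkCode L (linkPt L 0 iq) (linkPt L 0 i₁)) (linkCode L (linkPt L 0 iq) (linkPt L 0 i₂))
  have hM : ‖a' • F' (iotaPt (L ((linkPt L 0 iq).1 - 1)) (L (linkPt L 0 iq).1) (linkCode L (linkPt L 0 iq) 0)) +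
      a' • F' (iotaPt (L ((linkPt L 0 iq).1 - 1)) (L (linkPt L 0 iq).1) (linkCode L (linkPt L 0 iq) (linkPt L 0 i₁))) +
      a' • F' (iotaPt (L ((linkPt L 0 iq).1 - 1)) (L (linkPt L 0 iq).1) (linkCode L (linkPt L 0 iq) (linkPt L 0 i₂)))‖ =
      Real.sqrt 6 * a' := by
    rw [eM]; exact norm_frame_of_sq108 F' ha'pos.le hM108
  have hQz : a' • F' (iotaPt (L ((linkPt L 0 iq).1 - 1)) (L (linkPt L 0 iq).1) (linkCode L (linkPt L 0 iq) z)) -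
      a' • F' (iotaPt (L ((linkPt L 0 iq).1 - 1)) (L (linkPt L 0 iq).1) (linkCode L (linkPt L 0 iq) 0)) =
      -((2 : ℝ) / 3) • (a' • F' (iotaPt (L ((linkPt L 0 iq).1 - 1)) (L (linkPt L 0 iq).1) (linkCode L (linkPt L 0 iq) 0)) +
        a' • F' (iotaPt (L ((linkPt L 0 iq).1 - 1)) (L (linkPt L 0 iq).1) (linkCode L (linkPt L 0 iq) (linkPt L 0 i₁))) +
        a' • F' (iotaPt (L ((linkPt L 0 iq).1 - 1)) (L (linkPt L 0 iq).1) (linkCode L (linkPt L 0 iq) (linkPt L 0 i₂)))) := by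
    have eD : intVec (iotaTab (L ((linkPt L 0 iq).1 - 1)) (L (linkPt L 0 iq).1) (linkCode L (linkPt L 0 iq) z) -
        iotaTab (L ((linkPt L 0 iq).1 - 1)) (L (linkPt L 0 iq).1) (linkCode L (linkPt L 0 iq) 0)) =
        -((2 : ℝ) / 3) • intVec (iotaTab (L ((linkPt L 0 iq).1 - 1)) (L (linkPt L 0 iq).1) (linkCode L (linkPt L 0 iq) 0) +
          iotaTab (L ((linkPt L 0 iq).1 - 1)) (L (linkPt L 0 iq).1) (linkCode L (linkPt L 0 iq) (linkPt L 0 i₁)) +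
          iotaTab (L ((linkPt L 0 iq).1 - 1)) (L (linkPt L 0 iq).1) (linkCode L (linkPt L 0 iq) (linkPt L 0 i₂))) := by
      have h3 := congrArg intVec hDz
      rw [intVec_add, intVec_add, intVec_neg, intVec_add] at h3
      rw [show intVec (iotaTab (L ((linkPt L 0 iq).1 - 1)) (L (linkPt L 0 iq).1) (linkCode L (linkPt L 0 iq) z) -
          iotaTab (L ((linkPt L 0 iq).1 - 1)) (L (linkPt L 0 iq).1) (linkCode L (linkPt L 0 iq) 0)) = ((1 : ℝ) / 3) •
          (intVec (iotaTab (L ((linkPt L 0 iq).1 - 1)) (L (linkPt L 0 iq).1) (linkCode L (linkPt L 0 iq) z) -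
            iotaTab (L ((linkPt L 0 iq).1 - 1)) (L (linkPt L 0 iq).1) (linkCode L (linkPt L 0 iq) 0)) +
          intVec (iotaTab (L ((linkPt L 0 iq).1 - 1)) (L (linkPt L 0 iq).1) (linkCode L (linkPt L 0 iq) z) -
            iotaTab (L ((linkPt L 0 iq).1 - 1)) (L (linkPt L 0 iq).1) (linkCode L (linkPt L 0 iq) 0)) +
          intVec (iotaTab (L ((linkPt L 0 iq).1 - 1)) (L (linkPt L 0 iq).1) (linkCode L (linkPt L 0 iq) z) -
            iotaTab (L ((linkPt L 0 iq).1 - 1)) (L (linkPt L 0 iq).1) (linkCode L (linkPt L 0 iq) 0))) from by module, h3]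
      module
    rw [frame_sub, eD, eM, LinearIsometry.map_smul, LinearIsometry.map_smul, LinearIsometry.map_smul]
    module
  refine ⟨apex_cone hapos (hF1 iq) (hF1 i₁) (hF1 i₂) hN hwN ha'pos hx hh₁' hh₂' hz hM hQz, ?_⟩
  obtain ⟨hlo, hhi⟩ := apex_norm_bounds ha'pos.le hx hz hM hQz
  rw [dist_eq_norm]
  constructor <;> nlinarith

/-! ## ZZO-3  The competitor half of the pin step -/

/-- ★★ COMPETITOR CONE.  At a charted site `x` (chart `Ψ` of the two-shell-clean `S`, two shells of `x` in the chart domain) with the centre's frame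
`a, F` on the first shell and the pulled-back direction `w'` of rider ZZN `cell_at_site`: EVERY allowed competitor offset `z ∈ cellAllowed L cs` (rider
ZZH: a double with cap `1/2` or an apex with cap `5/9` against every corner of the cell) whose caps hold against `w'` is realised by the charted atom
`Ψ (x + z)` in the `60°`-cone of `w` at `Ψ x`, with `27/20 ≤ dist ≤ 17/8 (< 43/20)` — by `classI_dec`/`classI_cone` resp. `classII_dec`/`classII_cone`.
With `cell_at_site` (members) this is the geometric half of the pin step (c1). [this file, g81] -/
theorem competitor_cone {S : Set E3} {D : Set (ℤ × ℤ × ℤ)} {Ψ : ℤ × ℤ × ℤ → E3} {τ : ℤ → Bool} (hΨ : IsBarlowBondChart S D Ψ τ)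
    {x : ℤ × ℤ × ℤ} (hlD : ∀ i, linkPt τ x i ∈ D) (hl2D : ∀ i j, linkPt τ (linkPt τ x i) j ∈ D)
    (hclean : ∀ p ∈ S, IsTwoShellGoodSet (1 / 16) (9 / 10) 1 S p) {w w' : E3} {a : ℝ} {F : E3 →ₗᵢ[ℝ] E3}
    (ha : 9 / 10 ≤ a) (hn : ‖w'‖ = ‖w‖) (hFw : ∀ u : E3, ⟪F u, w⟫ = ⟪u, w'⟫)
    (hF1 : ∀ i : Fin 12, dist (Ψ (linkPt τ x i)) (Ψ x + a • F (iotaPt (τ (x.1 - 1)) (τ x.1) i)) ≤ 1 / 16 * a)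
    {L : ℤ → Bool} (hL : letters4 (τ (x.1 - 2)) (τ (x.1 - 1)) (τ x.1) (τ (x.1 + 1)) = L) {cs : List (Fin 3 → ℤ)}
    (hCAP : ∀ (num den : ℕ) (v : Fin 3 → ℤ), 0 < den → (∀ c ∈ cs, capZB num den v c = true) →
      Real.sqrt (num / den) * (‖intVec v‖ * ‖w'‖) ≤ ⟪intVec v, w'⟫)
    {z : ℤ × ℤ × ℤ} (hz : z ∈ cellAllowed L cs) :
    1 / 2 * (‖Ψ (x + z) - Ψ x‖ * ‖w‖) ≤ ⟪Ψ (x + z) - Ψ x, w⟫ ∧ 27 / 20 ≤ dist (Ψ (x + z)) (Ψ x) ∧ dist (Ψ (x + z)) (Ψ x) ≤ 17 / 8 := by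
  obtain ⟨h2, hcl⟩ := mem_cellAllowed.1 hz
  rcases hcl with ⟨h72, hc⟩ | ⟨h48, hc⟩
  · have hdec := classI_dec (τ (x.1 - 2)) (τ (x.1 - 1)) (τ x.1) (τ (x.1 + 1)) z
    rw [hL] at hdec
    obtain ⟨i, hi⟩ := hdec h2 h72
    obtain ⟨hcone, hlo, hhi⟩ := classI_cone hΨ hlD hl2D hclean ha hn hFw hF1 hL hi (hCAP 1 2 _ (by norm_num) hc)
    exact ⟨hcone, by linarith, hhi⟩
  · have hdec := classII_dec (τ (x.1 - 2)) (τ (x.1 - 1)) (τ x.1) (τ (x.1 + 1)) z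
    rw [hL] at hdec
    obtain ⟨iq, i₁, i₂, hi⟩ := hdec h2 h48
    obtain ⟨hcone, hlo, hhi⟩ := classII_cone hΨ hlD hl2D hclean ha hn hFw hF1 hL hi (hCAP 5 9 _ (by norm_num) hc)
    exact ⟨hcone, hlo, by linarith⟩

end Summit.AtomisticToContinuum.Crystallization.Theorems.ChartedZeroExcessLayeredLatticeLiouville
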